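import Summits.Ventures.HSemireg.AmplificationChainAssembly
import Summits.Ventures.HSemireg.PerfectComplexDoor
import Summits.Ventures.HSemireg.VoisinBarrierStatement
import Literature.AlgebraicGeometry.HodgeTheory.WeilTypeAbelianVariety
import Literature.AlgebraicGeometry.HodgeTheory.SemiregularityMapReal
import Literature.AlgebraicGeometry.HodgeTheory.ComplexGysin
import Literature.AlgebraicGeometry.HodgeTheory.AlgebraicClassesHodgeTypeHolds
import HarnessLib

/-!
# Venture HSemireg — the VOISIN BARRIER («no `h`, no semiregularity»): the STATEMENT of the cell's THEOREM V,
# typed on the tree's real carriers so that `general-structure/STRUCTURE.md` (S-G)/(S-F′) can cite a declaration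

HONEST FRAMING. Lean index of the computation cell `pub-hsemireg` (seat p7, Lean typer). This file TYPES A
STATEMENT; it proves nothing about it. `VoisinBarrier C` below is NOT a published theorem and NOT a Literature fact:
it is the statement of a SEAT-DERIVED result of the cell (gs-eng-1 gen 9, `general-structure/eng1/g9/NORM-VOISIN-gs-eng-1-g9.md`
§3 «THEOREM V», v1.1 = v1.3 cee370e2915ea3d3 (statement unchanged), 2026-08-22; status on the cell's ledger: ×1, recorded by the
target lead (RULING PASS 15), red team
routed (red-3 / red-6 / red-7 / ref / th-5), printed inputs pinned AS PRINTED by lit-1 in `lit/VOISIN-BARRIER-LOCATORS.md`),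
assembled on paper from printed results (Buchweitz–Flenner 2003 Thm. 5.1 and its proof; Voisin 2002; Bando–Siu) plus two
lemmas of the note. A proof in the tree would need analytic families of NON-algebraic complex tori, the module deformation
theory of [BuchweitzFlenner2003] §5/§7 over an analytic germ, and Voisin's theorem on analytic Chern classes — none of which
has a carrier at the pin; hence «proof can trail» (operator emphasis 2026-08-22T13:44:07Z, item (2)) means: STATEMENT
ONLY, taken by consumers as an explicit hypothesis `(hV : VoisinBarrier C)`. Nothing here constructs an object, nothing here
says HC, HC_CM or HC_AV is proved, and nothing here is a new case of anything: the barrier is a NEGATIVE statement about the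
Bloch / Buchweitz–Flenner METHOD («where not to look»).

TWO TYPINGS, ONE STATEMENT (lead RULINGS R-66 (b) / R-67 (a), 2026-08-22). The cell's statement FILE OF RECORD is
`VoisinBarrierStatement.lean` (seat gs-eng-1, the note's author): `VoisinBarrierHFree : Prop`, an `@[conjecture]` obligation
node, «interface form» — `∀ C` INSIDE, binders `2 ≤ n`, `A.dim = 2n`, `0 < d`, `φ ≫ φ = -(d • 𝟙 A)` and NO Weil-type
(signature) binder. THIS file is the «carrier form»: `VoisinBarrier C` with `C` a PARAMETER and the Weil-type binder
`IsWeilType A φ n d`, plus kernel bookkeeping and the cell's door currencies. §5 PROVES the two agree: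
`voisinBarrierHFree_iff : VoisinBarrierHFree ↔ ∀ C, VoisinBarrier C` — the signature binder is REDUNDANT (a non-zero
algebraic, hence `(n,n)`, class in the Weil plane forces Weil type: Deligne–Milne Prop. 4.4 ⇒, tree theorems
`isOfHodgeType_of_mem_algebraicClasses_of_isSmoothProjective`, `isWeilType_of_weilClass_ne_zero`), so neither typing is
stronger than the other, and `STRUCTURE.md` may cite either name.

## The statement being typed (the note's §3, verbatim)

«THEOREM V (no h ⇒ no semiregularity). Let `A` be an abelian variety of Weil type (`K ⊂ End⁰(A)` imaginary quadratic
acting with signature `(n,n)`, `n ≥ 2`; ANY discriminant, CM or not) and `E` a coherent sheaf on `A` with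
`ch(E) ∈ ℚ·1 ⊕ W_K ⊕ ℚ·[pt]` and non-zero `W_K`-component. Then `E` is not semiregular; more precisely, for NO subset
`I ⊆ {0,…,2n}` is the partial semiregularity map `σ_I : Ext²(E,E) → ∏_{p∈I} H^{p+1}(A, Ω^{p−1})` injective (BF03 §5
«I-semiregular»; `I` = all = the cell's «full σ injective»).»

Its printed inputs, AS PRINTED (lit-1, `lit/VOISIN-BARRIER-LOCATORS.md`): [Voisin2002KaehlerCounterexample] (IMRN 2002:20 =
arXiv:math/0112247; arXiv numbering throughout — one arXiv version exists, the IMRN pagination/numbering is not verified from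
holdings) §2 standing hypotheses «compact Kähler, dim `≥ 3`, (a) `NS(X) = 0`, (b) no proper closed analytic subset
of positive dimension, (c) `Hdg⁴(X,ℚ) ⊥ [ω]^{dim−2}` for SOME Kähler class» and Prop. 1 «any analytic coherent sheaf `F` on `X`
satisfies `c₂(F) = 0`» — the CRITERION the barrier consumes at `n = 2` (used at dim `4`), TOGETHER WITH §3 Prop. 3 (the general
complex torus of Weil type with `K = ℚ(i)`, type `(2,2)`: `NS = 0`, simple, `Hdg⁴ = ∧⁴_K Γ_ℚ` — it supplies (a), (c) and
`Hdg⁴ = W_K`; Thm. 1 is only the existence statement for ONE such torus and is not an input); Appendix (Bando–Siu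
[BandoSiu1994]) Thm. 2, Prop. 4, Cor. 1 under the standing assumptions «`Hdg² = 0` and `Hdg⁴ ⊥ ω^{dim−2}`» (the INPUT at
`n ≥ 3`), with the Appendix's closing note after Cor. 2 «the assumptions are satisfied by a general complex torus of dimension at
least 3»; [BuchweitzFlenner2003] Thm. 5.1 (p. 174–175) and the construction in its PROOF (p. 179 L22–38: 5.9 over the
infinitesimal neighbourhoods, a convergent versal deformation, Artin approximation — run inside BF's own analytic category on
an analytic deformation of the algebraic `X₀ = A`; the concluding word «algebraic» of 5.1 is not invoked). The note's own
lemmas: (V1) generic Hodge group of the `2n²`-dimensional `K`-torus family `⊇ Res_{K/ℚ} SL_{2n}` (so the Hodge classes of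
a very general fibre are `⟨1, W, pt⟩`), (V2) a very general fibre has no positive-dimensional proper analytic subset,
Lemma HL (an `h`-free class stays Hodge on the whole `K`-torus germ). MECHANISM in one sentence: semiregularity propagates
the sheaf, with the flat transport of its Chern character, over the whole Hodge locus of that character (BF 5.1, analytic
base); an `h`-free character stays Hodge on the non-projective `K`-tori, whose very general member carries no coherent
sheaf with a Weil Chern class (Voisin / Bando–Siu) — contradiction with `w ≠ 0`. (At that last step the Atiyah-class and the
topological Chern classes of the `S`-flat coherent `F_s` on the Kähler, non-projective fibres are identified by
[Grivaux2010DeligneChernCoherent] Cor. 6.5 / Rem. 6.6, arXiv:0712.2207 numbering — a cited input of the note, lit-1 / th-2 (P2);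
on those tori coherent sheaves need not have global locally free resolutions, Voisin Cor. 2.) BETTI vs ATIYAH `ch` (ref (c)):
the note applies BF 5.1 to the Hodge/Atiyah Chern character, while the hypotheses below are on the Betti `ch` of the tree's
`ChernCharacterBetti`; on the smooth projective `A` the Atiyah `ch` of a locally free `E` is the `(p,p)`-part of the Betti `ch`
(every `ch_p(E)` is algebraic, `ch_mem_algebraicClasses`, hence of type `(p,p)`), so Betti `h`-free ⇒ Atiyah `h`-free and the
typed hypothesis is the printed one.

## Rendering (tree vocabulary only; no new notion)

* «abelian variety of Weil type, signature `(n,n)`» = the tree's `HodgeTheory.IsWeilType A φ n d` (van Geemen 4.9 on the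
  real carriers: `A.dim = 2n`, `φ ≫ φ = -(d • 𝟙 A)`, multiplicity `n` of `i√d` on `H^{1,0}`; ANY discriminant, CM or not —
  nothing more is assumed); `n ≥ 2` = `2 ≤ n`.
* «`ch(E) ∈ ℚ·1 ⊕ W_K ⊕ ℚ·[pt]` with non-zero `W_K`-component» = `IsHFreeWeilCarrying A φ n d κ` for the tuple
  `κ_p = ch_p(E)`: `κ_p = 0` for `0 < p < 2n`, `p ≠ n` (`IsHFree`), `κ_n ∈ weilClassesOf A φ n d` (the tree's Weil plane
  `W_K ⊗ ℂ`; for the RATIONAL class `ch_n(E)` membership in `W_K ⊗ ℂ` is membership in `W_K`, ref-3 (P2)), `κ_n ≠ 0`. The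
  degree-`0` and degree-`2n` clauses («`∈ ℚ·1`», «`∈ ℚ·[pt]`») are automatic for a Chern
  character on a connected `2n`-fold (`b₀ = b_{4n} = 1`, `isRationalClass_ch`) and are omitted; degrees `> 2n` vanish
  (`IsHFree.eq_zero_of_isWeilType`, Grothendieck/Artin vanishing `subsingleton_complexBetti`).
* «`E` is not `I`-semiregular for any `I`» = `∀ I : Set ℕ, ¬ IsISemiregular hE I` with the tree's REAL Buchweitz–Flenner
  components `σ_q = Tr(∗ · At(E)^q)` (`SemiregularityHigherSigma.lean`, form-degree indexing; BF's `I ⊆ {0,…,2n}`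
  indexes `p = q + 1`; since the statement quantifies over ALL `I` no conversion is needed, and by monotonicity it is
  equivalent to «the full `σ` is not injective», `voisinBarrier_iff_not_isSemiregularReal`).
* SCOPE OF THE CARRIER — the one honest restriction: the tree's `σ` exists for FINITE LOCALLY FREE `E` only (module
  docstring of `SemiregularityMapReal.lean`: «perfect complexes / coherent `F` need the trace on perfect complexes, not in
  the tree»). So `VoisinBarrier C` is THEOREM V for VECTOR BUNDLES — a special case of the note's statement (coherent
  sheaves), i.e. NO strengthening. -- TODO(general form): coherent sheaves `E` (the note's scope; its proof uses that BF
  Thm. 5.1 is stated for modules), once the tree has `σ` for coherent / perfect objects.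
  For objects that are not vector bundles the file offers the SCHEMA `VoisinBarrierFor C Adm` over seat p4's
  `AdmissibilityNotion` (bounded complexes of vector bundles, e.g. a locally free resolution of a coherent sheaf, with
  `chPerfect`): at `Adm := bfAdmissible` it FOLLOWS from `VoisinBarrier C` (`VoisinBarrier.voisinBarrierFor_bfAdmissible`);
  at the intended «full `σ_E` injective» notion (no carrier) it is the note's FLAGGED, NOT COVERED extension (H-cx)
  («`E` a perfect COMPLEX that is not a sheaf — needs the complex analogue of BF03 5.9/5.1 over an analytic smooth germ»);
  at `Adm := rankAdmissible C` (seat p4's REAL rank class, [BuchweitzFlenner2008HH] Prop. 6.4.4 ⇒ full `σ` injective on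
  paper) it is the census's reading «an `h`-free `W`-carrying complex never passes the rank test» — likewise NOT covered by
  the note's proof. The other flagged hypothesis of the note, (H-G) (`G`-equivariant semiregularity, `σ` injective on
  `Ext²(E,E)^G` only), is not rendered here at all.
* `C : ChernCharacterBetti` is a PARAMETER (the tree's idiom; the barrier is a statement about the Chern character).
  THEOREM V proper is the instance `C =` the topological Chern character; `∀ C, VoisinBarrier C` (= gs-eng-1's node, §5)
  neither strengthens nor weakens it: by the cell's uniqueness lemma (th-2, `theory/TH2-CH-UNIQUENESS-LEMMA.md`
  v2 90ffe00e0abc058d; printed pattern [Fulton1998] Thm. 3.2 (d)(e), Splitting construction, Rem. 3.2.1, Betti side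
  [VoisinHodgeI2002] Lemma 7.32, Thm. 11.23 with Lemma 11.24 / Rem. 11.25) every
  `C : ChernCharacterBetti` is `ch_i ↦ λ_C^i · ch_i^{top}` for one `λ_C ∈ ℚˣ` on vector bundles over quasi-projective
  `ℂ`-schemes, and the hypothesis «`h`-free ∧ `ch_n ∈ W_K ∖ 0`» is invariant under such rescalings (ref precision (a),
  gs-red S1, lit-1 (i)/(ii): recorded once for every «`∀ C`» statement of this directory). That lemma is on paper, not in
  the kernel.

## Kernel content (PROVED here; all trivial bookkeeping — the mathematics is in the hypothesis `hV`)

`voisinBarrier_iff_not_isSemiregularReal` (the «more precisely» clause ⟺ «not semiregular»);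
`VoisinBarrier.weilComponent_eq_zero` («no `h`, no `W`»: an `I`-semiregular bundle with `h`-free Chern character and
middle component in the Weil plane has ZERO middle component); `VoisinBarrier.exists_ne_zero_of_isISemiregular` («no `h`,
no semiregularity»: an `I`-semiregular bundle carrying a non-zero Weil class in `ch_n` has `ch_p ≠ 0` for some
`0 < p < 2n`, `p ≠ n` — the (S-F′) POLARISATION CLAUSE for the untwisted sheaf; its «after every integral twist» form needs
«`E ⊗ L` semiregular ⟺ `E` semiregular», printed as the Atiyah-class shift under a rank-one twist [Markman2025SecantWeil]
Rem. 7.3.4 + Lemma 7.3.7 and [Markman2025SurveySecant] («`E ⊗ L^{-1}` is semi-regular, since `E` is by assumption»), which is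
not in the tree AS A GEOMETRIC IDENTITY on the real carriers — the transport lemma GIVEN the triangular re-expansion is th-4's
`isISemiregular_univ_iff_of_triangular`, `UntwistFullSigma.lean`); in the cell's DOOR
CURRENCIES: `VoisinBarrier.bfSheafClass_false` (the Buchweitz–Flenner sheaf door `bfSheafClass C` of
`AmplificationChainAssembly.lean` admits NO `h`-free `W`-carrying member on a Weil-type `2n`-fold, `n ≥ 2`, once
`I ⊇ {1,…,2n−1}` — the `q = 0`, `c = 0` seeds of `HasSeedOn (bfSheafClass C)`), `VoisinBarrierFor.anti`,
`VoisinBarrier.voisinBarrierFor_bfAdmissible`, `VoisinBarrierFor.perfectObjClass_false`; and the BRIDGE of §5,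
`VoisinBarrierHFree.voisinBarrier`, `voisinBarrierHFree_of_forall`, `voisinBarrierHFree_iff`, `isWeilType_of_isHFreeWeilCarrying_ch`.
CONSISTENCY (not kernel): every semiregular object of record in the cell has genuine `h`-exponentials in `ch`, as the barrier demands.

## References

[Voisin2002KaehlerCounterexample] C. Voisin, A counterexample to the Hodge conjecture extended to Kähler varieties, IMRN
2002:20, 1057–1075 = arXiv:math/0112247 (arXiv numbering), §2 Prop. 1, §3 Prop. 3, Appendix Thm. 2, Prop. 4, Cor. 1 and the
closing note after Cor. 2; [BandoSiu1994] S. Bando, Y.-T. Siu, Stable sheaves and Einstein–Hermitian metrics, in: Geometry and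
Analysis on Complex Manifolds, World Scientific 1994, 39–50 (Appendix Thm. 2 of Voisin); [BuchweitzFlenner2003] §5 Thm. 5.1 and
its proof p. 179, §5 (I-semiregular), Def. 4.1; [Grivaux2010DeligneChernCoherent] Cor. 6.5 / Rem. 6.6 (arXiv:0712.2207 numbering);
[BuchweitzFlenner2008HH] Prop. 6.4.4 (rank reading; arXiv:math/0606730 numbering = bib note); [vanGeemen1994HodgeAV] 4.9 (Weil
type), 4.10 and [Deligne1982HodgeCycles] §4 Prop. 4.4 (Weil plane `(n,n)` ⟺ Weil type — §5), 4.11 (Weil 1977: the Weil plane is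
not in the divisor ring); [Markman2025SecantWeil] Rem. 7.3.4, Lemma 7.3.7 / [Markman2025SurveySecant] (twist remark; preprints,
statement only); [Fulton1998] Thm. 3.2 (d)(e), Rem. 3.2.1 (uniqueness pattern behind the `∀ C` sentence); cell records:
NORM-VOISIN-gs-eng-1-g9.md §3–§4/§7 (v1.3), lit/VOISIN-{BARRIER-LOCATORS,LEAN-CITATIONS-READ}.md, ref/REVIEW-VOISIN-LEAN-STATEMENT-1.md, theory/TH2-CH-UNIQUENESS-LEMMA.md, STRUCTURE.md (S-G)/(S-F′)/§3.2″.
-/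

noncomputable section

open CategoryTheory

namespace Summit.Ventures.HSemireg

open Literature.AlgebraicGeometry Literature.AlgebraicGeometry.Motives
open Literature.AlgebraicGeometry.HodgeTheory
open Literature.AlgebraicGeometry.KTheory
open Literature.AlgebraicTopology.SingularHomology

/-! ## §1 The class condition «`ch ∈ ℚ·1 ⊕ W_K ⊕ ℚ·[pt]`, `W`-part `≠ 0`» on a tuple of even-degree classes -/

/-- **`h`-FREE tuple of classes** on a `2n`-fold (the note's «norm-type» / «`h`-free» vectors `v = r + w + s·pt`):
every component of degree `2p` with `0 < p < 2n`, `p ≠ n`, vanishes — the Chern character has no term outside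
degrees `0`, `2n` (middle) and `4n` (top) — no power `hᵏ`, `0 < k < 2n`, of a polarisation (degrees `> 2n`: `IsHFree.eq_zero_of_isWeilType`).
[cite: vanGeemen1994HodgeAV, 4.11 (the Weil plane vs. the divisor ring; the shape rendered is the cell note's §1–§3)] -/
def IsHFree (n : ℕ) {X : SchemeOver ℂ} (κ : (p : ℕ) → complexBetti X (2 * p)) : Prop :=
  ∀ p : ℕ, 0 < p → p < 2 * n → p ≠ n → κ p = 0

/-- **`h`-free AND `W`-carrying**: `κ` is `h`-free, and its middle component `κ_n ∈ H^{2n}(A(ℂ); ℂ)` is a NON-ZERO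
element of the Weil plane `weilClassesOf A φ n d = W_K ⊗ ℂ` of `(A, φ)`, `φ ≫ φ = -d` — the note's hypothesis
«`ch(E) ∈ ℚ·1 ⊕ W_K ⊕ ℚ·[pt]` and non-zero `W_K`-component» for `κ_p = ch_p(E)`.
[cite: vanGeemen1994HodgeAV, 4.9 (the space of Weil–Hodge classes)] -/
def IsHFreeWeilCarrying (A : AbelianVariety ℂ) (φ : A ⟶ A) (n d : ℕ)
    (κ : (p : ℕ) → complexBetti A.X (2 * p)) : Prop :=
  IsHFree n κ ∧ κ n ∈ weilClassesOf A φ n d ∧ κ n ≠ 0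

/-- On a Weil-type `2n`-fold an `h`-free tuple vanishes in EVERY degree `p ∉ {0, n, 2n}` (degrees `2p > 4n = dim_ℝ`
carry no cohomology: `subsingleton_complexBetti`). [folklore] -/
theorem IsHFree.eq_zero_of_isWeilType {A : AbelianVariety ℂ} {φ : A ⟶ A} {n d : ℕ} (hA : IsWeilType A φ n d)
    {κ : (p : ℕ) → complexBetti A.X (2 * p)} (h : IsHFree n κ) {p : ℕ} (hp0 : p ≠ 0) (hpn : p ≠ n)
    (hp2n : p ≠ 2 * n) : κ p = 0 := by
  by_cases hlt : p < 2 * n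
  · exact h p (Nat.pos_of_ne_zero hp0) hlt hpn
  · haveI := subsingleton_complexBetti hA.isSmoothProjective (k := 2 * p) (by omega)
    exact Subsingleton.elim _ _

/-- Unfolding `IsHFreeWeilCarrying` (definitional). [folklore] -/
theorem isHFreeWeilCarrying_iff {A : AbelianVariety ℂ} {φ : A ⟶ A} {n d : ℕ}
    {κ : (p : ℕ) → complexBetti A.X (2 * p)} :
    IsHFreeWeilCarrying A φ n d κ ↔
      (∀ p : ℕ, 0 < p → p < 2 * n → p ≠ n → κ p = 0) ∧ κ n ∈ weilClassesOf A φ n d ∧ κ n ≠ 0 :=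
  Iff.rfl

/-! ## §2 THEOREM V of the cell (the Voisin barrier) — STATEMENT, for vector bundles on the real carriers -/

/-- **THE VOISIN BARRIER — the cell's THEOREM V («no `h` ⇒ no semiregularity»), STATEMENT ONLY** (seat-derived ×1,
gs-eng-1 gen 9, NORM-VOISIN §3; NOT a published theorem, NOT proved here — consumers take `(hV : VoisinBarrier C)`):
for every abelian variety of Weil type `(A, φ)` of signature `(n, n)`, `n ≥ 2` (any `K = ℚ(√-d)`, any discriminant,
CM or not; the tree's `IsWeilType A φ n d`) and every FINITE LOCALLY FREE `E` on `A` whose Chern character (in the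
theory `C`) is `h`-free and `W`-carrying — `ch_p(E) = 0` for `0 < p < 2n`, `p ≠ n`, and `ch_n(E)` a non-zero class of
the Weil plane —, `E` is NOT `I`-semiregular for ANY set `I` of form degrees: no part `(σ_q)_{q ∈ I}` of the real
Buchweitz–Flenner semiregularity map `Ext²(E,E) → ∏_q H^{q+2}(A, Ω^q)` is jointly injective. The note states it for
every coherent SHEAF `E`; the tree's `σ` has a carrier for vector bundles only, so this is the locally free case (no
strengthening; complexes / general coherent sheaves: the schema `VoisinBarrierFor`). On paper it follows from
[BuchweitzFlenner2003] Thm. 5.1 (proof, p. 179) run over the analytic `2n²`-dimensional `K`-torus family and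
[Voisin2002KaehlerCounterexample] §2 Prop. 1 with §3 Prop. 3 (`n = 2`), Appendix Thm. 2 ([BandoSiu1994]), Prop. 4, Cor. 1
(`n ≥ 3`) on its very general member, plus the note's lemmas (V1), (V2), HL. Same statement as the cell's file of record
`VoisinBarrierHFree` (`VoisinBarrierStatement.lean`; `∀ C` inside, no signature binder): `voisinBarrierHFree_iff` (§5).
[cite: Voisin2002KaehlerCounterexample, §2 Prop. 1 + §3 Prop. 3 (n = 2); Appendix Thm. 2 / Prop. 4 / Cor. 1 (n ≥ 3) (arXiv:math/0112247 numbering; printed INPUTS of the cell's derivation; the statement itself is the cell's, not Voisin's)]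
[cite: BuchweitzFlenner2003, §5 Thm. 5.1 (proof p. 179 L22–38) and §5 (I-semiregular)] -/
def VoisinBarrier (C : ChernCharacterBetti) : Prop :=
  ∀ ⦃A : AbelianVariety ℂ⦄ ⦃φ : A ⟶ A⦄ ⦃n d : ℕ⦄, IsWeilType A φ n d → 2 ≤ n →
    ∀ ⦃E : A.X.left.Modules⦄ (hE : IsFiniteLocallyFree E),
      IsHFreeWeilCarrying A φ n d (fun p => C.ch A.X E p) → ∀ I : Set ℕ, ¬ IsISemiregular hE I

/-! ## §3 Kernel consequences (bookkeeping; the content is the hypothesis `hV`) -/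

/-- **The «more precisely» clause ⟺ «not semiregular»**: since `I`-semiregularity for any `I` implies semiregularity
(full `σ` injective, `IsISemiregular.isSemiregularReal`) and semiregular = `Set.univ`-semiregular, the barrier is
equivalently «no `h`-free `W`-carrying vector bundle on a Weil-type `2n`-fold, `n ≥ 2`, is semiregular»
(`IsSemiregularReal`). [cite: BuchweitzFlenner2003, §5 (I-semiregular) and Def. 4.1] -/
theorem voisinBarrier_iff_not_isSemiregularReal (C : ChernCharacterBetti) :
    VoisinBarrier C ↔
      ∀ ⦃A : AbelianVariety ℂ⦄ ⦃φ : A ⟶ A⦄ ⦃n d : ℕ⦄, IsWeilType A φ n d → 2 ≤ n →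
        ∀ ⦃E : A.X.left.Modules⦄ (hE : IsFiniteLocallyFree E),
          IsHFreeWeilCarrying A φ n d (fun p => C.ch A.X E p) → ¬ IsSemiregularReal hE := by
  constructor
  · intro h A φ n d hA hn E hE hch hsr
    exact h hA hn hE hch Set.univ ((isISemiregular_univ_iff_isSemiregularReal hE).2 hsr)
  · intro h A φ n d hA hn E hE hch I hI
    exact h hA hn hE hch (IsISemiregular.isSemiregularReal hE hI)

/-- **Not semiregular** (consumer shape of the previous lemma). [cite: BuchweitzFlenner2003, Def. 4.1] -/
theorem VoisinBarrier.not_isSemiregularReal {C : ChernCharacterBetti} (hV : VoisinBarrier C)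
    {A : AbelianVariety ℂ} {φ : A ⟶ A} {n d : ℕ} (hA : IsWeilType A φ n d) (hn : 2 ≤ n)
    {E : A.X.left.Modules} (hE : IsFiniteLocallyFree E)
    (hch : IsHFreeWeilCarrying A φ n d (fun p => C.ch A.X E p)) : ¬ IsSemiregularReal hE :=
  (voisinBarrier_iff_not_isSemiregularReal C).1 hV hA hn hE hch

/-- **«No `h`, no `W`»**: under the barrier, an `I`-semiregular vector bundle on a Weil-type `2n`-fold (`n ≥ 2`) whose
Chern character is `h`-free with middle component in the Weil plane has ZERO middle component — semiregular `h`-free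
objects see no Weil class. [cite: BuchweitzFlenner2003, §5 Thm. 5.1 (the mechanism, via the cell's THEOREM V)] -/
theorem VoisinBarrier.weilComponent_eq_zero {C : ChernCharacterBetti} (hV : VoisinBarrier C)
    {A : AbelianVariety ℂ} {φ : A ⟶ A} {n d : ℕ} (hA : IsWeilType A φ n d) (hn : 2 ≤ n)
    {E : A.X.left.Modules} (hE : IsFiniteLocallyFree E) {I : Set ℕ} (hsr : IsISemiregular hE I)
    (hfree : IsHFree n (fun p => C.ch A.X E p)) (hW : C.ch A.X E n ∈ weilClassesOf A φ n d) :
    C.ch A.X E n = 0 := by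
  by_contra h0
  exact hV hA hn hE ⟨hfree, hW, h0⟩ I hsr

/-- **«No `h`, no semiregularity» — the POLARISATION CLAUSE (S-F′) for the untwisted object**: under the barrier, an
`I`-semiregular vector bundle on a Weil-type `2n`-fold (`n ≥ 2`) whose `ch_n` is a NON-ZERO class of the Weil plane has
a non-zero Chern character component in some degree `p` with `0 < p < 2n`, `p ≠ n` (an «`h`-term»). (The note's form
«after every integral twist `e^ℓ`» additionally uses «`E ⊗ L` semiregular ⟺ `E` semiregular» — in print the Atiyah-class
shift under a rank-one twist, [Markman2025SecantWeil] Rem. 7.3.4 / Lemma 7.3.7; not in the tree as a geometric identity on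
the real carriers; given the triangular re-expansion, the transport is th-4's `isISemiregular_univ_iff_of_triangular`.)
[cite: BuchweitzFlenner2003, §5 Thm. 5.1 (the mechanism, via the cell's THEOREM V)] -/
theorem VoisinBarrier.exists_ne_zero_of_isISemiregular {C : ChernCharacterBetti} (hV : VoisinBarrier C)
    {A : AbelianVariety ℂ} {φ : A ⟶ A} {n d : ℕ} (hA : IsWeilType A φ n d) (hn : 2 ≤ n)
    {E : A.X.left.Modules} (hE : IsFiniteLocallyFree E) {I : Set ℕ} (hsr : IsISemiregular hE I)
    (hW : C.ch A.X E n ∈ weilClassesOf A φ n d) (h0 : C.ch A.X E n ≠ 0) :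
    ∃ p : ℕ, 0 < p ∧ p < 2 * n ∧ p ≠ n ∧ C.ch A.X E p ≠ 0 := by
  by_contra hno
  push Not at hno
  exact hV hA hn hE ⟨fun p hp0 hplt hpn => hno p hp0 hplt hpn, hW, h0⟩ I hsr

/-! ## §4 In the cell's door currencies -/

/-- **The Buchweitz–Flenner SHEAF DOOR admits no `h`-free `W`-carrying member** (cell currency: seat p7's
`bfSheafClass C` — «`(κ_p)_{p ∈ I}` are the `ch_p` of an `I`-semiregular finite locally free `ℰ₀`»): under the barrier,
on a Weil-type `2n`-fold with `n ≥ 2`, if `I ⊇ {1, …, 2n−1}` then no `κ` admissible for `bfSheafClass C` is `h`-free on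
`I` with `κ_n` a non-zero Weil class. These are exactly the `q = 0`, `c = 0` seeds of `HasSeedOn (bfSheafClass C)`
(`κ_n = 0·hⁿ + w`, `κ_p = 0·hᵖ`): the δ-blind door is CLOSED for sheaves, «dead by the barrier before any `σ` is
computed» (STRUCTURE (S-G)). [cite: BuchweitzFlenner2003, §5 (I-semiregular) and Thm. 5.1] -/
theorem VoisinBarrier.bfSheafClass_false {C : ChernCharacterBetti} (hV : VoisinBarrier C)
    {A : AbelianVariety ℂ} {φ : A ⟶ A} {n d : ℕ} (hA : IsWeilType A φ n d) (hn : 2 ≤ n)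
    {m : ℕ} {I : Finset ℕ} (hI : ∀ p : ℕ, 0 < p → p < 2 * n → p ∈ I)
    {κ : (p : ℕ) → complexBetti A.X (2 * p)} (hκ : bfSheafClass C m A.X I κ)
    (hoff : ∀ p ∈ I, 0 < p → p < 2 * n → p ≠ n → κ p = 0)
    (hW : κ n ∈ weilClassesOf A φ n d) (h0 : κ n ≠ 0) : False := by
  obtain ⟨E₀, hE₀, hsr, hch⟩ := hκ
  have hnI : n ∈ I := hI n (by omega) (by omega)
  refine hV hA hn hE₀ ⟨?_, ?_, ?_⟩ _ hsr
  · intro p hp0 hplt hpn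
    have hpI : p ∈ I := hI p hp0 hplt
    change C.ch A.X E₀ p = 0
    rw [← hch p hpI]
    exact hoff p hpI hp0 hplt hpn
  · change C.ch A.X E₀ n ∈ weilClassesOf A φ n d
    rw [← hch n hnI]
    exact hW
  · change C.ch A.X E₀ n ≠ 0
    rw [← hch n hnI]
    exact h0

/-- **THE BARRIER FOR AN ADMISSIBILITY NOTION `Adm` on bounded complexes of vector bundles** (SCHEMA in `Adm`, seat
p4's `AdmissibilityNotion`; STATEMENT ONLY): on every Weil-type `2n`-fold `(A, φ)`, `n ≥ 2`, NO bounded complex of vector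
bundles `E` whose Chern character `chPerfect C A.X E` is `h`-free and `W`-carrying is `Adm`-admissible, for any finite
set `I` of Chern degrees. Readings: `Adm := bfAdmissible` (a single `I`-semiregular vector bundle in degree `0`) — FOLLOWS
from `VoisinBarrier C` (`VoisinBarrier.voisinBarrierFor_bfAdmissible`); the INTENDED «`Ext^{<0} = 0`, simple, full `σ_E`
injective» (no carrier in the tree) — the note's extension (H-cx) to perfect complexes, explicitly FLAGGED AS NOT COVERED
by its proof («needs the complex analogue of BF03 5.9/5.1 over an analytic smooth germ»), which is what a coherent sheaf
that is not a vector bundle (through a locally free resolution) or a genuine complex (the cell's route-(C) objects)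
requires; `Adm := rankAdmissible C` (p4's REAL rank class; [BuchweitzFlenner2008HH] Prop. 6.4.4 gives full `σ`
injective on paper) — the census reading «an `h`-free `W`-carrying complex never passes the rank test», likewise NOT
covered. Nothing asserted. [cite: BuchweitzFlenner2003, Def. 4.1 and §5 Thm. 5.1]
[cite: BuchweitzFlenner2008HH, Prop. 6.4.4 (rank reading; arXiv:math/0606730 numbering = bib note)] -/
def VoisinBarrierFor (C : ChernCharacterBetti) (Adm : AdmissibilityNotion) : Prop :=
  ∀ ⦃A : AbelianVariety ℂ⦄ ⦃φ : A ⟶ A⦄ ⦃n d : ℕ⦄, IsWeilType A φ n d → 2 ≤ n →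
    ∀ ⦃E : CochainComplex A.X.left.Modules ℤ⦄ (hE : IsBoundedVBComplex E),
      IsHFreeWeilCarrying A φ n d (chPerfect C A.X E hE.isFiniteLocallyFree) →
        ∀ I : Finset ℕ, ¬ Adm (2 * n) A.X I E

/-- **Monotonicity in the admissibility notion**: the barrier for a WIDER notion `Adm` (more admissible objects) gives
the barrier for every narrower `Adm'`. [folklore] -/
theorem VoisinBarrierFor.anti {C : ChernCharacterBetti} {Adm Adm' : AdmissibilityNotion}
    (hle : ∀ n X₀ I E, Adm' n X₀ I E → Adm n X₀ I E) (h : VoisinBarrierFor C Adm) :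
    VoisinBarrierFor C Adm' :=
  fun _ _ _ _ hA hn _ hE hch I hI => h hA hn hE hch I (hle _ _ _ _ hI)

/-- **Sanity instance: at `Adm := bfAdmissible` the schema FOLLOWS from the vector-bundle statement.** A BF-admissible
complex is a single finite locally free `E⁰` in degree `0`, `{q | q+1 ∈ I}`-semiregular, and `ch(E•) = ch(E⁰)`
(`chPerfect_eq_ch_zero`); apply `VoisinBarrier C` to `E⁰`. [cite: BuchweitzFlenner2003, §5 (I-semiregular)] -/
theorem VoisinBarrier.voisinBarrierFor_bfAdmissible {C : ChernCharacterBetti} (hV : VoisinBarrier C) :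
    VoisinBarrierFor C bfAdmissible := by
  intro A φ n d hA hn E hE hch I hAdm
  obtain ⟨hE₀, hz, hsr⟩ := hAdm
  have hch0 : (fun p => C.ch A.X (E.X 0) p) = chPerfect C A.X E hE.isFiniteLocallyFree := by
    funext p
    exact (chPerfect_eq_ch_zero C A.X E hE.isFiniteLocallyFree hz p).symm
  have hch' : IsHFreeWeilCarrying A φ n d (fun p => C.ch A.X (E.X 0) p) := by
    rw [hch0]
    exact hch
  exact hV hA hn hE₀ hch' {q | q + 1 ∈ I} hsr

/-- **The perfect-complex door admits no `h`-free `W`-carrying member** (cell currency: seat p4's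
`perfectObjClass C Adm`, the object class of route (C)): under the barrier FOR `Adm`, on a Weil-type `2n`-fold with
`n ≥ 2`, if `I ⊇ {1, …, 2n−1}` then no `κ` of the class `perfectObjClass C Adm (2n) A.X I` is `h`-free on `I` with `κ_n`
a non-zero Weil class. [cite: BuchweitzFlenner2003, Def. 4.1 (semiregularity of a perfect complex; schema in `Adm`)] -/
theorem VoisinBarrierFor.perfectObjClass_false {C : ChernCharacterBetti} {Adm : AdmissibilityNotion}
    (hV : VoisinBarrierFor C Adm) {A : AbelianVariety ℂ} {φ : A ⟶ A} {n d : ℕ} (hA : IsWeilType A φ n d)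
    (hn : 2 ≤ n) {I : Finset ℕ} (hI : ∀ p : ℕ, 0 < p → p < 2 * n → p ∈ I)
    {κ : (p : ℕ) → complexBetti A.X (2 * p)} (hκ : perfectObjClass C Adm (2 * n) A.X I κ)
    (hoff : ∀ p ∈ I, 0 < p → p < 2 * n → p ≠ n → κ p = 0)
    (hW : κ n ∈ weilClassesOf A φ n d) (h0 : κ n ≠ 0) : False := by
  obtain ⟨E, hE, hAdm, hch⟩ := hκ
  have hnI : n ∈ I := hI n (by omega) (by omega)
  refine hV hA hn hE ⟨?_, ?_, ?_⟩ I hAdm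
  · intro p hp0 hplt hpn
    have hpI : p ∈ I := hI p hp0 hplt
    rw [← hch p hpI]
    exact hoff p hpI hp0 hplt hpn
  · rw [← hch n hnI]
    exact hW
  · rw [← hch n hnI]
    exact h0

/-! ## §5 BRIDGE to the cell's statement file of record (`VoisinBarrierStatement.lean`, seat gs-eng-1): ONE statement, two typings

`VoisinBarrierHFree` (interface form: `∀ C` inside; binders `2 ≤ n`, `A.dim = 2n`, `0 < d`, `φ ≫ φ = -(d • 𝟙 A)`; NO
signature binder) and `∀ C, VoisinBarrier C` (carrier form: `IsWeilType A φ n d`, `2 ≤ n`) are EQUIVALENT in the kernel.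
The one non-trivial point is ref's precision (b) / th-2's binder (1): the Weil-type (signature `(n,n)`) condition is
AUTOMATIC under the class hypothesis — `ch_n(E)` is algebraic (`ChernCharacterBetti.ch_mem_algebraicClasses`), hence of
Hodge type `(n,n)` (`isOfHodgeType_of_mem_algebraicClasses_of_isSmoothProjective`, Voisin I Prop. 11.20 in the tree), and a
NON-ZERO `(n,n)` class in the Weil plane forces Weil type (`isWeilType_of_weilClass_ne_zero`, Deligne–Milne Prop. 4.4 ⇒).
So R-67 (a)'s «statement of record names BOTH decls once» names one proposition. -/

/-- **The signature binder is redundant**: on a `2n`-dimensional abelian variety (`n ≥ 1`) with `φ ≫ φ = -d`, `d ≥ 1`, a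
finite locally free `E` whose `ch_n` (in any Chern character theory `C`) is a NON-ZERO class of the Weil plane forces
`(A, φ)` to be of Weil type `(n, d)` — `ch_n(E)` is algebraic, hence `(n,n)`, and Deligne–Milne Prop. 4.4 (⇒) applies.
[cite: Deligne1982HodgeCycles, §4 Prop. 4.4] [cite: VoisinHodgeI2002, §11.1.3 Prop. 11.20 (algebraic ⇒ Hodge)] -/
theorem isWeilType_of_isHFreeWeilCarrying_ch (C : ChernCharacterBetti) {A : AbelianVariety ℂ} {φ : A ⟶ A} {n d : ℕ}
    (hn : 0 < n) (hA : A.dim = 2 * n) (hd : 0 < d) (hφ : φ ≫ φ = -(d • 𝟙 A))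
    {E : A.X.left.Modules} (hE : IsFiniteLocallyFree E)
    (hW : C.ch A.X E n ∈ weilClassesOf A φ n d) (h0 : C.ch A.X E n ≠ 0) : IsWeilType A φ n d := by
  have hX : IsSmoothProjective (2 * n) A.X := Motives.isSmoothProjective_of_dim_eq' hA
  have halg : C.ch A.X E n ∈ algebraicClasses A.X n := C.ch_mem_algebraicClasses hX E hE.isVectorBundle n
  exact isWeilType_of_weilClass_ne_zero hn hd hA hφ hW h0
    (isOfHodgeType_of_mem_algebraicClasses_of_isSmoothProjective hX n halg)

/-- **Interface form ⇒ carrier form**: `VoisinBarrierHFree` gives `VoisinBarrier C` for every `C` (`IsWeilType` supplies the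
dimension, `d ≥ 1` and `φ² = -d` binders; the `h`-free / `W`-carrying clauses are literally the same).
[cite: BuchweitzFlenner2003, §5 (I-semiregular; the statement bridged is the cell's THEOREM V)] -/
theorem VoisinBarrierHFree.voisinBarrier (hV : VoisinBarrierHFree) (C : ChernCharacterBetti) : VoisinBarrier C :=
  fun A φ n d hA hn E hE hch I ↦
    hV C A φ n d hn hA.dim_eq hA.d_pos hA.sq_eq E hE hch.1 hch.2.1 hch.2.2 I

/-- **Carrier form for all `C` ⇒ interface form**: the missing Weil-type binder is produced by
`isWeilType_of_isHFreeWeilCarrying_ch`. [cite: Deligne1982HodgeCycles, §4 Prop. 4.4] -/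
theorem voisinBarrierHFree_of_forall (h : ∀ C : ChernCharacterBetti, VoisinBarrier C) : VoisinBarrierHFree := by
  intro C A φ n d hn hA hd hφ E hE hfree hW hne I
  have hWT : IsWeilType A φ n d := isWeilType_of_isHFreeWeilCarrying_ch C (by omega) hA hd hφ hE hW hne
  exact h C hWT hn hE ⟨hfree, hW, hne⟩ I

/-- **ONE STATEMENT, TWO TYPINGS**: the cell's file-of-record node `VoisinBarrierHFree` (gs-eng-1, `VoisinBarrierStatement.lean`)
is EQUIVALENT to the carrier form of this file for all Chern character theories, `∀ C, VoisinBarrier C`. Neither is a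
strengthening of the other; `STRUCTURE.md` (S-G)/(S-F′) may cite either name (lead R-67 (a)).
[cite: Deligne1982HodgeCycles, §4 Prop. 4.4 (the only mathematics in the bridge)] -/
theorem voisinBarrierHFree_iff : VoisinBarrierHFree ↔ ∀ C : ChernCharacterBetti, VoisinBarrier C :=
  ⟨fun hV C ↦ hV.voisinBarrier C, voisinBarrierHFree_of_forall⟩

end Summit.Ventures.HSemireg

end
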